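import Summits.AtomisticToContinuum.Crystallization.Theorems.ChargedEnergyGapPassage
import HarnessLib

/-!
# Charged energy gap — lens-3 g65, node «BarlowRef» (R3) — part 28b «MarginWalk»: first exit and the paying frontier along a segment

Line `stmt-AtomisticToContinuum-14231`, item 4 of the residual of record (the tube block EXHIBITION, part 25).  Two one-dimensional walks
along the segment `t ↦ y + t•(z − y)`, both pure metric geometry:

* §1 FIRST EXIT: for a closed set `S ⊆ ℝ` of «critical» parameters with `0 ∉ S` that meets `[0, 1]`, the least critical parameter `t⋆ ∈ (0, 1]`
  has `[0, t⋆) ∩ S = ∅`; a continuous function `> K` on `[0, t⋆)` is `≥ K` at `t⋆`.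
* §2 THE CRITICAL POINT of the margins: with the level `d(·, C)` and the listed distances `d(·, Dᵢ)` continuous along the segment, if the
  source end is super-critical (`d(y, C) > L`, `d(y, Dᵢ) > a` where `σᵢ`, `< b` where `¬σᵢ`) and some parameter in `[0, 1]` is critical, there
  is a first critical point `p⋆ = y + t⋆•(z − y)`: all margins hold NON-STRICTLY on `[0, t⋆]` and one of them is TIGHT at `p⋆`.  Members
  within `δ` of `p⋆` inherit the margins up to `δ` and the tight one up to `δ` (so they are in the shell or carry a transition).
* §3 THE PAYING FRONTIER: if every point of the segment up to `t₁` has a GOOD or a BAD site within `ε`, the source end has a good site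
  within `ε`, and no bad site within `ε` of that part of the segment has a good site within `K ≥ 2ε + (step)`, then the point at `t₁` has a
  good site within `ε` (supremum walk with steps shorter than `K − 2ε`).

ELEMENTARY · PROVED, 0 sorry.
-/

noncomputable section

open scoped Classical

open Literature.MathematicalPhysics.StatisticalMechanics Literature.Geometry.DiscreteGeometry
open Summit.AtomisticToContinuum.Crystallization.Theses.PricedLinkCensus
open Summit.AtomisticToContinuum.Crystallization.Theorems.ChargedEnergyGapNegative

namespace Summit.AtomisticToContinuum.Crystallization.Theorems.ChargedEnergyGapChartDial

/-! ## §1 First exit -/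

section FirstExit

/-- ★ FIRST EXIT: for a closed set `S` of parameters not containing `0` but meeting `[0, 1]`, the least element `t⋆ = sInf (S ∩ [0, 1])` lies in
`(0, 1] ∩ S` and no parameter of `[0, t⋆)` lies in `S`. -/
theorem first_exit_spec {S : Set ℝ} (hS : IsClosed S) (h0 : (0 : ℝ) ∉ S) {t₁ : ℝ} (ht₁ : t₁ ∈ Set.Icc (0 : ℝ) 1) (ht₁S : t₁ ∈ S) :
    0 < sInf (S ∩ Set.Icc 0 1) ∧ sInf (S ∩ Set.Icc 0 1) ≤ 1 ∧ sInf (S ∩ Set.Icc 0 1) ∈ S ∧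
      ∀ t, 0 ≤ t → t < sInf (S ∩ Set.Icc 0 1) → t ∉ S := by
  set S' : Set ℝ := S ∩ Set.Icc 0 1 with hS'
  have hS'c : IsClosed S' := hS.inter isClosed_Icc
  have hne : S'.Nonempty := ⟨t₁, ht₁S, ht₁⟩
  have hbdd : BddBelow S' := ⟨0, fun t ht => ht.2.1⟩
  have hmem : sInf S' ∈ S' := hS'c.csInf_mem hne hbdd
  refine ⟨?_, hmem.2.2, hmem.1, fun t ht0 hlt htS => ?_⟩
  · rcases hmem.2.1.eq_or_lt with h | h
    · exact absurd (h ▸ hmem.1) h0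
    · exact h
  · have : sInf S' ≤ t := csInf_le hbdd ⟨htS, ht0, hlt.le.trans hmem.2.2⟩
    linarith

/-- A continuous function that is `> K` on `[0, t⋆)` (`t⋆ > 0`) is `≥ K` at `t⋆`. -/
theorem le_of_lt_on_Ico {f : ℝ → ℝ} (hf : Continuous f) {K ts : ℝ} (hts : 0 < ts) (h : ∀ t, 0 ≤ t → t < ts → K < f t) : K ≤ f ts := by
  have hsub : Set.Ico 0 ts ⊆ {t | K < f t} := fun t ht => h t ht.1 ht.2
  have hcl : closure (Set.Ico 0 ts) ⊆ {t | K ≤ f t} :=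
    (closure_mono hsub).trans (closure_lt_subset_le continuous_const hf)
  have hmem : ts ∈ closure (Set.Ico (0 : ℝ) ts) := by
    rw [closure_Ico hts.ne]
    exact ⟨hts.le, le_rfl⟩
  exact hcl hmem

/-- The mirror statement: `< K` on `[0, t⋆)` gives `≤ K` at `t⋆`. -/
theorem ge_of_gt_on_Ico {f : ℝ → ℝ} (hf : Continuous f) {K ts : ℝ} (hts : 0 < ts) (h : ∀ t, 0 ≤ t → t < ts → f t < K) : f ts ≤ K := by
  have := le_of_lt_on_Ico (f := fun t => -f t) (by fun_prop) hts (K := -K) (fun t h0 h1 => by linarith [h t h0 h1])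
  linarith

end FirstExit

/-! ## §2 The critical point of the margins -/

section Critical

variable {m : ℕ} (C : Set E3) (D : Fin m → Set E3) (σ : Fin m → Bool)

/-- The CRITICAL PARAMETERS of the segment from `y` to `z` for the thresholds `(L, a, b)`: the level is `≤ L`, or some listed set with
`σᵢ = true` is at distance `≤ a`, or some listed set with `σᵢ = false` is at distance `≥ b`. -/
def criticalSet (L a b : ℝ) (y z : E3) : Set ℝ :=
  {t | Metric.infDist (y + t • (z - y)) C ≤ L ∨
    ∃ i, (σ i = true ∧ Metric.infDist (y + t • (z - y)) (D i) ≤ a) ∨ (σ i = false ∧ b ≤ Metric.infDist (y + t • (z - y)) (D i))}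

variable {C D σ}

/-- Membership in the critical set, definitionally. [formal bookkeeping] -/
theorem mem_criticalSet_iff {L a b : ℝ} {y z : E3} {t : ℝ} : t ∈ criticalSet C D σ L a b y z ↔
    Metric.infDist (y + t • (z - y)) C ≤ L ∨ ∃ i, (σ i = true ∧ Metric.infDist (y + t • (z - y)) (D i) ≤ a) ∨
      (σ i = false ∧ b ≤ Metric.infDist (y + t • (z - y)) (D i)) :=
  Iff.rfl

/-- The path `t ↦ y + t•(z − y)` is continuous. [formal bookkeeping] -/
theorem continuous_linePath (y z : E3) : Continuous fun t : ℝ => y + t • (z - y) :=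
  continuous_const.add (continuous_id.smul continuous_const)

/-- The critical set is closed (finitely many closed conditions on continuous functions). -/
theorem isClosed_criticalSet (L a b : ℝ) (y z : E3) : IsClosed (criticalSet C D σ L a b y z) := by
  have hp := continuous_linePath y z
  have hC : Continuous fun t : ℝ => Metric.infDist (y + t • (z - y)) C := (Metric.continuous_infDist_pt C).comp hp
  have hD : ∀ i, Continuous fun t : ℝ => Metric.infDist (y + t • (z - y)) (D i) := fun i => (Metric.continuous_infDist_pt _).comp hp
  have h : criticalSet C D σ L a b y z = {t : ℝ | Metric.infDist (y + t • (z - y)) C ≤ L} ∪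
      ⋃ i, ({t : ℝ | σ i = true ∧ Metric.infDist (y + t • (z - y)) (D i) ≤ a} ∪ {t | σ i = false ∧ b ≤ Metric.infDist (y + t • (z - y)) (D i)}) := by
    ext t
    simp only [criticalSet, Set.mem_setOf_eq, Set.mem_union, Set.mem_iUnion]
  rw [h]
  refine IsClosed.union (isClosed_le hC continuous_const) (isClosed_iUnion_of_finite fun i => IsClosed.union ?_ ?_)
  · by_cases hi : σ i = true
    · simpa [hi] using isClosed_le (hD i) continuous_const
    · simp [hi]
  · by_cases hi : σ i = false
    · simpa [hi] using isClosed_le continuous_const (hD i)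
    · simp [hi]

/-- ★★ **THE FIRST CRITICAL POINT.**  If the source end is super-critical — `L < d(y, C)`, `a < d(y, Dᵢ)` where `σᵢ`, `d(y, Dᵢ) < b` where
`¬σᵢ` — and some parameter of `[0, 1]` is critical, then the least critical parameter `t⋆ = sInf (criticalSet ∩ [0, 1]) ∈ (0, 1]` is such that
along `[0, t⋆]` all margins hold (`d ≥ L`, `dᵢ ≥ a` resp. `≤ b`) and at `p⋆ = y + t⋆•(z − y)` one of them is tight (`d(p⋆, C) ≤ L`, or `d(p⋆, Dᵢ) ≤ a` for some `σᵢ = true`, or `≥ b` for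
some `σᵢ = false`). -/
theorem first_critical_spec {L a b : ℝ} {y z : E3} (hyL : L < Metric.infDist y C)
    (hya : ∀ i, σ i = true → a < Metric.infDist y (D i)) (hyb : ∀ i, σ i = false → Metric.infDist y (D i) < b)
    {t₁ : ℝ} (ht₁ : t₁ ∈ Set.Icc (0 : ℝ) 1) (ht₁S : t₁ ∈ criticalSet C D σ L a b y z) :
    0 < sInf (criticalSet C D σ L a b y z ∩ Set.Icc 0 1) ∧ sInf (criticalSet C D σ L a b y z ∩ Set.Icc 0 1) ≤ 1 ∧
      sInf (criticalSet C D σ L a b y z ∩ Set.Icc 0 1) ∈ criticalSet C D σ L a b y z ∧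
      ∀ t, 0 ≤ t → t ≤ sInf (criticalSet C D σ L a b y z ∩ Set.Icc 0 1) → L ≤ Metric.infDist (y + t • (z - y)) C ∧
        (∀ i, σ i = true → a ≤ Metric.infDist (y + t • (z - y)) (D i)) ∧ (∀ i, σ i = false → Metric.infDist (y + t • (z - y)) (D i) ≤ b) := by
  have h0 : (0 : ℝ) ∉ criticalSet C D σ L a b y z := by
    intro h
    simp only [criticalSet, Set.mem_setOf_eq, zero_smul, add_zero] at h
    rcases h with h | ⟨i, ⟨hi, h⟩ | ⟨hi, h⟩⟩
    · linarith
    · linarith [hya i hi]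
    · linarith [hyb i hi]
  obtain ⟨hts0, hts1, htsS, hfree⟩ := first_exit_spec (isClosed_criticalSet L a b y z) h0 ht₁ ht₁S
  set ts := sInf (criticalSet C D σ L a b y z ∩ Set.Icc 0 1) with hts
  refine ⟨hts0, hts1, htsS, fun t ht0 hle => ?_⟩
  have hp := continuous_linePath y z
  -- the strict margins on `[0, t)` for every `t ≤ ts`, by non-criticality
  have hstrict : ∀ u, 0 ≤ u → u < ts → L < Metric.infDist (y + u • (z - y)) C ∧
      (∀ i, σ i = true → a < Metric.infDist (y + u • (z - y)) (D i)) ∧ (∀ i, σ i = false → Metric.infDist (y + u • (z - y)) (D i) < b) := by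
    intro u hu0 hu
    have hn := hfree u hu0 hu
    simp only [criticalSet, Set.mem_setOf_eq, not_or, not_exists, not_and, not_le] at hn
    exact ⟨hn.1, fun i hi => (hn.2 i).1 hi, fun i hi => (hn.2 i).2 hi⟩
  rcases hle.lt_or_eq with hlt | heq
  · obtain ⟨h1, h2, h3⟩ := hstrict t ht0 hlt
    exact ⟨h1.le, fun i hi => (h2 i hi).le, fun i hi => (h3 i hi).le⟩
  · subst heq
    refine ⟨?_, fun i hi => ?_, fun i hi => ?_⟩
    · exact le_of_lt_on_Ico ((Metric.continuous_infDist_pt C).comp hp) hts0 fun u hu0 hu => (hstrict u hu0 hu).1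
    · exact le_of_lt_on_Ico ((Metric.continuous_infDist_pt _).comp hp) hts0 fun u hu0 hu => (hstrict u hu0 hu).2.1 i hi
    · exact ge_of_gt_on_Ico ((Metric.continuous_infDist_pt _).comp hp) hts0 fun u hu0 hu => (hstrict u hu0 hu).2.2 i hi

/-- ★ **MEMBERS NEAR A CRITICAL POINT.**  If at `p` the margins `d(p, C) ≥ L`, `d(p, Dᵢ) ≥ a` / `≤ b` hold and one is tight, then every `c`
with `dist c p ≤ δ` has level `≥ L − δ`, listed distances `≥ a − δ` / `≤ b + δ`, and EITHER level `≤ L + δ` OR some listed set at distance in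
`[a − δ, a + δ]` (`σᵢ = true`) or in `[b − δ, b + δ]` (`σᵢ = false`). -/
theorem member_of_critical {L a b δ : ℝ} {p c : E3} (hd : dist c p ≤ δ) (hL : L ≤ Metric.infDist p C)
    (ha : ∀ i, σ i = true → a ≤ Metric.infDist p (D i)) (hb : ∀ i, σ i = false → Metric.infDist p (D i) ≤ b)
    (htight : Metric.infDist p C ≤ L ∨ ∃ i, (σ i = true ∧ Metric.infDist p (D i) ≤ a) ∨ (σ i = false ∧ b ≤ Metric.infDist p (D i))) :
    L - δ ≤ Metric.infDist c C ∧ (∀ i, σ i = true → a - δ ≤ Metric.infDist c (D i)) ∧ (∀ i, σ i = false → Metric.infDist c (D i) ≤ b + δ) ∧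
      (Metric.infDist c C ≤ L + δ ∨ ∃ i, a - δ ≤ Metric.infDist c (D i) ∧ Metric.infDist c (D i) ≤ a + δ ∨
        b - δ ≤ Metric.infDist c (D i) ∧ Metric.infDist c (D i) ≤ b + δ) := by
  have hC := abs_infDist_sub_infDist_le (C := C) c p
  have hDi : ∀ i, |Metric.infDist c (D i) - Metric.infDist p (D i)| ≤ dist c p := fun i => abs_infDist_sub_infDist_le (C := D i) c p
  rw [abs_le] at hC
  have hDi' : ∀ i, -dist c p ≤ Metric.infDist c (D i) - Metric.infDist p (D i) ∧ Metric.infDist c (D i) - Metric.infDist p (D i) ≤ dist c p :=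
    fun i => abs_le.1 (hDi i)
  refine ⟨by linarith [hC.1], fun i hi => by linarith [(hDi' i).1, ha i hi], fun i hi => by linarith [(hDi' i).2, hb i hi], ?_⟩
  rcases htight with h | ⟨i, ⟨hi, h⟩ | ⟨hi, h⟩⟩
  · exact Or.inl (by linarith [hC.2])
  · exact Or.inr ⟨i, Or.inl ⟨by linarith [(hDi' i).1, ha i hi], by linarith [(hDi' i).2]⟩⟩
  · exact Or.inr ⟨i, Or.inr ⟨by linarith [(hDi' i).1], by linarith [(hDi' i).2, hb i hi]⟩⟩

end Critical

/-! ## §3 The paying frontier -/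

section Frontier

/-- ★★ **THE PAYING FRONTIER.**  Along `t ↦ y + t•(z − y)` up to `t₁ ∈ [0, 1]`: if every point has a GOOD or a BAD site within `ε`, the source
end `y` has a good site within `ε`, and no bad site within `ε` of a point of this part of the segment has a good site within `K`, where
`K ≥ 2ε + η·dist y z` for a step `η > 0`, then the point at `t₁` has a good site within `ε`.  (Supremum walk: the good parameters are closed
upwards in steps of `η`.) -/
theorem exists_good_at_end {Good Bad : E3 → Prop} {y z : E3} {ε K η t₁ : ℝ} (hη : 0 < η) (hK : 2 * ε + η * dist y z ≤ K)
    (ht₁ : t₁ ∈ Set.Icc (0 : ℝ) 1)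
    (hcover : ∀ t, 0 ≤ t → t ≤ t₁ → ∃ q : E3, dist q (y + t • (z - y)) ≤ ε ∧ (Good q ∨ Bad q))
    (hstart : ∃ q : E3, Good q ∧ dist q y ≤ ε)
    (hsep : ∀ q c : E3, Good q → Bad c → (∃ t, 0 ≤ t ∧ t ≤ t₁ ∧ dist c (y + t • (z - y)) ≤ ε) → dist q c ≤ K → False) :
    ∃ q : E3, Good q ∧ dist q (y + t₁ • (z - y)) ≤ ε := by
  -- the set of good parameters
  set A : Set ℝ := {t | 0 ≤ t ∧ t ≤ t₁ ∧ ∃ q : E3, Good q ∧ dist q (y + t • (z - y)) ≤ ε} with hA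
  have h0A : (0 : ℝ) ∈ A := by
    obtain ⟨q, hq, hqy⟩ := hstart
    exact ⟨le_rfl, ht₁.1, q, hq, by simpa using hqy⟩
  have hAne : A.Nonempty := ⟨0, h0A⟩
  have hAbdd : BddAbove A := ⟨t₁, fun t ht => ht.2.1⟩
  -- distances along the path
  have hpath : ∀ t t' : ℝ, dist (y + t • (z - y)) (y + t' • (z - y)) = |t - t'| * dist y z := by
    intro t t'
    rw [dist_eq_norm, dist_eq_norm, show y + t • (z - y) - (y + t' • (z - y)) = (t - t') • (z - y) by rw [sub_smul]; abel, norm_smul,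
      Real.norm_eq_abs, ← norm_neg (z - y), neg_sub]
  -- a good parameter `t` forces every parameter within `η` above it (up to `t₁`) to be good
  have hstep : ∀ t ∈ A, ∀ t', t ≤ t' → t' ≤ t₁ → t' - t ≤ η → t' ∈ A := by
    intro t ht t' htt' ht'1 hη'
    have ht'0 : 0 ≤ t' := ht.1.trans htt'
    obtain ⟨q', hq'd, hq'⟩ := hcover t' ht'0 ht'1
    rcases hq' with hg | hb
    · exact ⟨ht'0, ht'1, q', hg, hq'd⟩
    · exfalso
      obtain ⟨q, hq, hqd⟩ := ht.2.2
      refine hsep q q' hq hb ⟨t', ht'0, ht'1, hq'd⟩ ?_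
      calc dist q q' ≤ dist q (y + t • (z - y)) + dist (y + t • (z - y)) (y + t' • (z - y)) + dist (y + t' • (z - y)) q' :=
            dist_triangle4 _ _ _ _
        _ ≤ ε + η * dist y z + ε := by
            rw [hpath, dist_comm _ q']
            have : |t - t'| ≤ η := by rw [abs_sub_comm, abs_of_nonneg (by linarith)]; exact hη'
            have h2 : |t - t'| * dist y z ≤ η * dist y z := mul_le_mul_of_nonneg_right this dist_nonneg
            linarith
        _ ≤ K := by linarith
  -- supremum walk
  by_contra hcon
  have ht₁A : t₁ ∉ A := fun h => hcon h.2.2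
  set τ := sSup A with hτ
  have hτ1 : τ ≤ t₁ := csSup_le hAne fun t ht => ht.2.1
  -- a good parameter just below `τ`
  obtain ⟨t, htA, hτt⟩ : ∃ t ∈ A, τ - η / 2 < t := by
    have h := exists_lt_of_lt_csSup hAne (show τ - η / 2 < τ by linarith)
    obtain ⟨t, ht, hlt⟩ := h
    exact ⟨t, ht, hlt⟩
  have htτ : t ≤ τ := le_csSup hAbdd htA
  -- step from `t` to `min (t + η) t₁`
  set t' := min (t + η) t₁ with ht'
  have ht'A : t' ∈ A := hstep t htA t' (le_min (by linarith) htA.2.1) (min_le_right _ _) (by have := min_le_left (t + η) t₁; linarith)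
  have ht'τ : t' ≤ τ := le_csSup hAbdd ht'A
  rcases le_total (t + η) t₁ with h | h
  · have : t' = t + η := min_eq_left h
    linarith
  · have : t' = t₁ := min_eq_right h
    exact ht₁A (this ▸ ht'A)

end Frontier

end Summit.AtomisticToContinuum.Crystallization.Theorems.ChargedEnergyGapChartDial

end
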